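import Literature.AnabelianGeometry.AbsoluteAnabelian.AbsTopII.TwoTripodNodalRetractions
import HarnessLib

/-!
# [AbsTopII] Prop 1.3 (viii) at the two-vertex nodal datum, II: `D_ε ∩ γ D_{ε'} γ⁻¹` for the ten pairs of distinct edges

S. Mochizuki, *Topics in Absolute Anabelian Geometry II* [AbsTopII] (bib `MochizukiAbsTopII2013`; locators =
PDF pages of the kurims manuscript `paper:url-585b8d0ad0d9`), §1 Prop 1.3 (viii) p. 12; Ribes–Zalesskii Thm. 9.1.12
[cite: RibesZalesskii2010, Thm. 9.1.12].

PROOF-ONLY companion of `AbsTopII/TwoTripodNodalDatum.lean` (abc-iut-f-066 gen 6, follow-on «P13viii-TWO-VERTEX» of row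
«P13v-TWO-VERTEX»), part II over `TwoTripodNodalRetractions.lean`.  At `M.dpsc` (node `e` joining `v_A`, `v_B`; cusps
`c₁, c₂` at `v_A`, `c₃, c₀` at `v_B`; `I_{v_A} = T`, `I_{v_B} = U`; every `Σ`), for EVERY `γ ∈ Π_𝔾`:

* the decomposition groups: `D_e = Π_e·T = Π_e·U` (`DvNode_eq_WT`, `DvNode_eq_WU`), `D_{c_j} = Π_{c_j}·T` (`j = 1, 2`),
  `Π_{c_j}·U` (`j = 3, 0`) (`DvCusp_one_eq`, …);
* **SAME VERTEX** (`pair_same` at six free bases of `Γ_{0,4}`): for the twelve ordered pairs of distinct edges at a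
  common vertex `v`, `D_ε ∩ γ D_{ε'} γ⁻¹ = I_v ∩ Z_P(γ)` EXACTLY (`Dc1_inf_conj_Dc2`, `De_inf_conj_Dc3`, …) — so its
  `Π_𝔾`-part is trivial and it is `I_v` whenever `γ ∈ Π_v`;
* **NO COMMON VERTEX** (`pair_cross`): for the eight ordered pairs `(c_i, c_j)` with `c_i` at `v_A`, `c_j` at `v_B`,
  `D_{c_i} ∩ γ D_{c_j} γ⁻¹ = 1` (`Dc1_inf_conj_Dc3_eq_bot`, …).
Two free bases of `Γ_{0,4}` beyond abc-iut-L3's four are built here: `(c₁, c₀⁻¹, c₃)` and `(c₁c₂, c₂, c₀⁻¹)`.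
Part III (`TwoTripodNodalProp13viii.lean`) assembles the typed `Prop_1_3_viii'` from these — unconditionally except for
the «Moreover» at an arbitrary conjugate, which needs «an element of `Π_𝔾` centralising a non-trivial element of `I_v`
lies in `Π_v`» for ALL non-trivial elements of `I_v ≅ Ẑ^Σ` (abc-iut-f-066's KEY₂ `mem_vertGpA_of_commute_pow_T` covers
the powers `t₀ⁿ`, i.e. the elements generating an open subgroup).  HONEST FRAMING: classical profinite group theory at a
constructed model (constructed ≠ geometric); nothing here bears on [IUTchIII] Cor 3.12; no side taken.
-/

noncomputable section

open scoped Pointwise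

namespace Literature.AnabelianGeometry.AbsoluteAnabelian.AbsTopII.TwoTripodNodal.Model

open Literature.AnabelianGeometry.SemiGraphs
open Literature.AnabelianGeometry.SemiGraphs.SemiGraphOfAnabelioids (IsProSigmaCompletion)
open Literature.AnabelianGeometry.SemiGraphs.SemiGraphOfAnabelioids.IsProSigmaCompletion
open Literature.AnabelianGeometry.Anabelioids (IsSigmaInteger)
open Literature.GroupTheory.CombinatorialGroupTheory
open Literature.GroupTheory.CombinatorialGroupTheory.PuncturedSurfaceGroup
open Literature.GroupTheory.CombinatorialGroupTheory.FreeFactorFibredTwist (lift_apply_basis)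
open _root_.Topology

variable {Sigma : Set ℕ} (M : Model Sigma)

/-! ### Retractions killing whole cyclic closures -/

/-- A continuous endomorphism of `Π_𝔾` killing `y` kills `closure ⟨y⟩`. [cite: RibesZalesskii2010, Lemma 3.2.1] -/
theorem apply_eq_one_of_mem_closure_zpowers (R : ↥M.PiG →* ↥M.PiG) (hRc : Continuous R) {y : ↥M.PiG} (hy : R y = 1) :
    ∀ a ∈ (Subgroup.zpowers y).topologicalClosure, R a = 1 := by
  intro a ha
  have hle : (Subgroup.zpowers y).topologicalClosure ≤ R.ker :=
    Subgroup.topologicalClosure_minimal _ ((Subgroup.zpowers_le).mpr (by rw [MonoidHom.mem_ker]; exact hy))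
      (by rw [MonoidHom.coe_ker]; exact isClosed_singleton.preimage hRc)
  exact hle ha

/-- **Separating retraction** for a free basis `(b₀,b₁,b₂)` and an index `j`: conjugation-invariant, the identity on
`closure ⟨κG(b_j)⟩`, trivial on `closure ⟨κG(b_i)⟩` for `i ≠ j`. [cite: RibesZalesskii2010, Thm. 9.1.12] -/
theorem exists_retraction₂ (b : FreeGroupBasis (Fin 3) (PuncturedSurfaceGroup 0 4)) (j : Fin 3) :
    ∃ R : ↥M.PiG →* ↥M.PiG,
      (∀ (s : M.P) (x : ↥M.PiG) (hsx : s * (x : M.P) * s⁻¹ ∈ M.PiG), R ⟨s * x * s⁻¹, hsx⟩ = R x) ∧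
      (∀ a ∈ (Subgroup.zpowers (M.κG (b j))).topologicalClosure, R a = a) ∧
      ∀ i, i ≠ j → ∀ a ∈ (Subgroup.zpowers (M.κG (b i))).topologicalClosure, R a = 1 := by
  obtain ⟨R, hRc, hRA, -, hkill, hconj⟩ := M.exists_retraction b j
  exact ⟨R, hconj, hRA, fun i hi => M.apply_eq_one_of_mem_closure_zpowers R hRc (hkill i hi)⟩

/-! ### The edge groups as cyclic closures -/

/-- `Π_{c_j} = closure ⟨κG(c_j)⟩`. [cite: MochizukiCombGC2007, Def 1.1(ii) p.7] -/
theorem cuspGp_eq_closure_zpowers (j : Fin 4) : M.cuspGp j = (Subgroup.zpowers (M.κG (c j))).topologicalClosure := by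
  rw [Model.cuspGp, PuncturedSurfaceGroup.cuspInertia, MonoidHom.map_zpowers]

/-- `Π_{c₀} = closure ⟨κG(c₀⁻¹)⟩`. [cite: MochizukiCombGC2007, Def 1.1(ii) p.7] -/
theorem cuspGp_zero_eq_closure_zpowers_inv :
    M.cuspGp 0 = (Subgroup.zpowers (M.κG (c 0)⁻¹)).topologicalClosure := by
  rw [cuspGp_eq_closure_zpowers, map_inv, Subgroup.zpowers_inv]

/-- `Π_e = closure ⟨κG(c₁c₂)⟩`. [cite: MochizukiCombGC2007, Def 1.1(ii) p.7] -/
theorem nodeGp_eq_closure_zpowers : M.nodeGp = (Subgroup.zpowers (M.κG (c 1 * c 2))).topologicalClosure := by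
  rw [Model.nodeGp, MonoidHom.map_zpowers]

/-! ### Two more free bases of `Γ_{0,4}` -/

/-- **Basis `(c₁, c₀⁻¹, c₃)`** of `Γ_{0,4}` (`c₀⁻¹ = c₁c₂c₃`). [cite: MochizukiSemiAnbd2006, Ex. 2.10 p.31] -/
theorem exists_freeGroupBasis_c1_c0inv_c3 :
    ∃ b : FreeGroupBasis (Fin 3) (PuncturedSurfaceGroup 0 4), b 0 = c 1 ∧ b 1 = (c 0)⁻¹ ∧ b 2 = c 3 := by
  obtain ⟨b₀, hb₀⟩ := exists_freeGroupBasis_succ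
  obtain ⟨b, hb⟩ := exists_freeGroupBasis_of_lifts b₀ ![b₀ 0, b₀ 0 * b₀ 1 * b₀ 2, b₀ 2]
    ![b₀ 0, (b₀ 0)⁻¹ * b₀ 1 * (b₀ 2)⁻¹, b₀ 2]
    (fun i => by fin_cases i <;> simp [mul_assoc])
    (fun i => by fin_cases i <;> simp [mul_assoc])
  refine ⟨b, ?_, ?_, ?_⟩
  · rw [hb]; simp [hb₀]
  · rw [hb, c_zero_eq_inv, inv_inv]; simp [hb₀]
  · rw [hb]; simp [hb₀]

/-- **Basis `(c₁c₂, c₂, c₀⁻¹)`** of `Γ_{0,4}`. [cite: MochizukiSemiAnbd2006, Ex. 2.10 p.31] -/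
theorem exists_freeGroupBasis_node_c2_c0inv :
    ∃ b : FreeGroupBasis (Fin 3) (PuncturedSurfaceGroup 0 4), b 0 = c 1 * c 2 ∧ b 1 = c 2 ∧ b 2 = (c 0)⁻¹ := by
  obtain ⟨b₀, hb₀0, hb₀1, hb₀2⟩ := exists_freeGroupBasis_node_two
  obtain ⟨b, hb⟩ := exists_freeGroupBasis_of_lifts b₀ ![b₀ 0, b₀ 1, b₀ 0 * b₀ 2] ![b₀ 0, b₀ 1, (b₀ 0)⁻¹ * b₀ 2]
    (fun i => by fin_cases i <;> simp)
    (fun i => by fin_cases i <;> simp)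
  refine ⟨b, ?_, ?_, ?_⟩
  · rw [hb]; simp [hb₀0]
  · rw [hb]; simp [hb₀1]
  · rw [hb, c_zero_eq_inv, inv_inv]; simp [hb₀0, hb₀2, mul_assoc]

/-! ### The decomposition groups of the five edges -/

/-- `D_e = Π_e · T`. [cite: MochizukiAbsTopII2013, Prop 1.3 (vii) p.12] -/
theorem DvNode_eq_WT (hne : Sigma.Nonempty) (hprime : ∀ p ∈ Sigma, p.Prime) (e : (M.dpsc hne hprime).Node) :
    (M.dpsc hne hprime).DvNode e = (M.nodeGp).map M.PiG.subtype ⊔ M.T := by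
  have h := (M.prop13vii_node_dpsc hne hprime e).2.2
  rw [dpsc_PiI, inf_top_eq, IvNode_eq_J] at h
  exact h.symm

/-- `D_e = Π_e · U`. [cite: MochizukiAbsTopII2013, Prop 1.3 (vii) p.12] -/
theorem DvNode_eq_WU (hne : Sigma.Nonempty) (hprime : ∀ p ∈ Sigma, p.Prime) (e : (M.dpsc hne hprime).Node) :
    (M.dpsc hne hprime).DvNode e = (M.nodeGp).map M.PiG.subtype ⊔ M.U := by
  rw [DvNode_eq_WT, ← T_sup_U_eq_WT, T_sup_U_eq_WU]

/-- `D_{c_j} = Π_{c_j} · S` for a section `S` centralising `Π_{c_j}`. [cite: MochizukiAbsTopII2013, Prop 1.3 (vii) p.12] -/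
theorem DvCusp_eq_sup (hne : Sigma.Nonempty) (hprime : ∀ p ∈ Sigma, p.Prime) (j : Fin 4) (S : Subgroup M.P)
    (hS : S ≤ Subgroup.centralizer (((M.cuspGp j).map M.PiG.subtype : Subgroup M.P) : Set M.P))
    (hSG : S ⊔ M.PiG = ⊤) :
    (M.dpsc hne hprime).DvCusp ⟨j⟩ = (M.cuspGp j).map M.PiG.subtype ⊔ S := by
  have hK : Subgroup.Commensurable.commensurator ((M.cuspGp j).map M.PiG.subtype) ⊓ M.PiG ≤
      (M.cuspGp j).map M.PiG.subtype := by
    have h : Subgroup.Commensurable.commensurator ((M.cuspGp j).map M.PiG.subtype) ⊓ M.PiG.subtype.range ≤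
        (M.cuspGp j).map M.PiG.subtype :=
      (isCommensurablyTerminal_subgroupOf_iff ((M.dpsc hne hprime).cuspSub_le ⟨j⟩)).mp
        (M.isCommensurablyTerminal_cuspSub hne hprime ⟨j⟩)
    rwa [Subgroup.range_subtype] at h
  exact (M.decomposition_of_section _ S hK hS hSG).1

/-- `T · Π_𝔾 = P`. [cite: MochizukiAbsTopII2013, Def 1.2 (ii) p.10] -/
theorem T_sup_PiG : M.T ⊔ M.PiG = ⊤ := by rw [sup_comm]; exact M.PiG_sup_T

/-- `D_{c₁} = Π_{c₁} · T`. [cite: MochizukiAbsTopII2013, Prop 1.3 (vii) p.12] -/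
theorem DvCusp_one_eq (hne : Sigma.Nonempty) (hprime : ∀ p ∈ Sigma, p.Prime) :
    (M.dpsc hne hprime).DvCusp ⟨(1 : Fin 4)⟩ = (M.cuspGp 1).map M.PiG.subtype ⊔ M.T :=
  M.DvCusp_eq_sup hne hprime 1 M.T (M.T_le_centralizer_cuspGp M.twist_c_one) M.T_sup_PiG

/-- `D_{c₂} = Π_{c₂} · T`. [cite: MochizukiAbsTopII2013, Prop 1.3 (vii) p.12] -/
theorem DvCusp_two_eq (hne : Sigma.Nonempty) (hprime : ∀ p ∈ Sigma, p.Prime) :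
    (M.dpsc hne hprime).DvCusp ⟨(2 : Fin 4)⟩ = (M.cuspGp 2).map M.PiG.subtype ⊔ M.T :=
  M.DvCusp_eq_sup hne hprime 2 M.T (M.T_le_centralizer_cuspGp M.twist_c_two) M.T_sup_PiG

/-- `D_{c₃} = Π_{c₃} · U`. [cite: MochizukiAbsTopII2013, Prop 1.3 (vii) p.12] -/
theorem DvCusp_three_eq (hne : Sigma.Nonempty) (hprime : ∀ p ∈ Sigma, p.Prime) :
    (M.dpsc hne hprime).DvCusp ⟨(3 : Fin 4)⟩ = (M.cuspGp 3).map M.PiG.subtype ⊔ M.U :=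
  M.DvCusp_eq_sup hne hprime 3 M.U (M.U_le_centralizer_cuspGp M.twist_c_three) M.U_sup_PiG

/-- `D_{c₀} = Π_{c₀} · U`. [cite: MochizukiAbsTopII2013, Prop 1.3 (vii) p.12] -/
theorem DvCusp_zero_eq (hne : Sigma.Nonempty) (hprime : ∀ p ∈ Sigma, p.Prime) :
    (M.dpsc hne hprime).DvCusp ⟨(0 : Fin 4)⟩ = (M.cuspGp 0).map M.PiG.subtype ⊔ M.U :=
  M.DvCusp_eq_sup hne hprime 0 M.U (M.U_le_centralizer_cuspGp M.twist_c_zero) M.U_sup_PiG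

/-- `T` centralises `ι(Π_e)`. [cite: MochizukiAbsTopII2013, Prop 1.3 (ii) p.11] -/
theorem T_le_centralizer_W : M.T ≤ Subgroup.centralizer (((M.nodeGp).map M.PiG.subtype : Subgroup M.P) : Set M.P) :=
  fun t ht => Subgroup.mem_centralizer_iff.mpr fun a ha => M.W_commute_T a ha t ht

/-- `U` centralises `ι(Π_e)`. [cite: MochizukiAbsTopII2013, Prop 1.3 (ii) p.11] -/
theorem U_le_centralizer_W : M.U ≤ Subgroup.centralizer (((M.nodeGp).map M.PiG.subtype : Subgroup M.P) : Set M.P) :=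
  fun u hu => Subgroup.mem_centralizer_iff.mpr fun a ha => M.W_commute_U a ha u hu

/-! ### The two pair mechanisms at a free basis -/

/-- **Same-vertex pairs at a basis**: if `K₀ = closure⟨κG(b_j)⟩`, `K₀' = closure⟨κG(b_{j'})⟩` (`j ≠ j'`) and the section
`S` (`S ∩ Π_𝔾 = 1`) centralises both, then `(K₀·S) ∩ γ(K₀'·S)γ⁻¹ = S ∩ Z(γ)` for every `γ ∈ Π_𝔾`.
[cite: MochizukiAbsTopII2013, Prop 1.3 (viii) p.12] -/
theorem pair_same (b : FreeGroupBasis (Fin 3) (PuncturedSurfaceGroup 0 4)) {j j' : Fin 3} (hjj' : j ≠ j')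
    (K₀ K₀' : Subgroup ↥M.PiG) (hK : K₀ = (Subgroup.zpowers (M.κG (b j))).topologicalClosure)
    (hK' : K₀' = (Subgroup.zpowers (M.κG (b j'))).topologicalClosure) (S : Subgroup M.P) (hSbot : S ⊓ M.PiG = ⊥)
    (hSK : S ≤ Subgroup.centralizer ((K₀.map M.PiG.subtype : Subgroup M.P) : Set M.P))
    (hSK' : S ≤ Subgroup.centralizer ((K₀'.map M.PiG.subtype : Subgroup M.P) : Set M.P)) {γ : M.P} (hγ : γ ∈ M.PiG) :
    (K₀.map M.PiG.subtype ⊔ S) ⊓ MulAut.conj γ • (K₀'.map M.PiG.subtype ⊔ S) =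
      S ⊓ Subgroup.centralizer ({γ} : Set M.P) := by
  obtain ⟨R, hR, hRfix, hRkill⟩ := M.exists_retraction₂ b j
  obtain ⟨R', hR', hR'fix, hR'kill⟩ := M.exists_retraction₂ b j'
  subst hK hK'
  exact M.inf_conj_eq_inf_centralizer _ _ S hSbot hSK hSK' R R' hR hRfix (hRkill j' (Ne.symm hjj')) hR' hR'fix
    (hR'kill j hjj') hγ

/-- **Cross pairs at a basis**: if `K₀ = closure⟨κG(b_j)⟩` is centralised by `T`, `K₀' = closure⟨κG(b_{j'})⟩` by `U`, and
`Π_e = closure⟨κG(b_{j_W})⟩` for three distinct indices, then `(K₀·T) ∩ γ(K₀'·U)γ⁻¹ = 1` for every `γ ∈ Π_𝔾`.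
[cite: MochizukiAbsTopII2013, Prop 1.3 (viii) p.12] -/
theorem pair_cross (b : FreeGroupBasis (Fin 3) (PuncturedSurfaceGroup 0 4)) {j j' jW : Fin 3} (hjj' : j ≠ j')
    (hjW : j ≠ jW) (hj'W : j' ≠ jW) (K₀ K₀' : Subgroup ↥M.PiG)
    (hK : K₀ = (Subgroup.zpowers (M.κG (b j))).topologicalClosure)
    (hK' : K₀' = (Subgroup.zpowers (M.κG (b j'))).topologicalClosure)
    (hW : M.nodeGp = (Subgroup.zpowers (M.κG (b jW))).topologicalClosure)
    (hTK : M.T ≤ Subgroup.centralizer ((K₀.map M.PiG.subtype : Subgroup M.P) : Set M.P))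
    (hUK' : M.U ≤ Subgroup.centralizer ((K₀'.map M.PiG.subtype : Subgroup M.P) : Set M.P)) {γ : M.P} (hγ : γ ∈ M.PiG) :
    (K₀.map M.PiG.subtype ⊔ M.T) ⊓ MulAut.conj γ • (K₀'.map M.PiG.subtype ⊔ M.U) = ⊥ := by
  obtain ⟨R₁, hR₁, hR₁fix, hR₁kill⟩ := M.exists_retraction₂ b j
  obtain ⟨R₂, hR₂, hR₂fix, hR₂kill⟩ := M.exists_retraction₂ b j'
  obtain ⟨R₃, hR₃, hR₃fix, -⟩ := M.exists_retraction₂ b jW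
  subst hK hK'
  have hW₁ : ∀ a ∈ M.nodeGp, R₁ a = 1 := fun a ha => hR₁kill jW (Ne.symm hjW) a (hW ▸ ha)
  have hW₂ : ∀ a ∈ M.nodeGp, R₂ a = 1 := fun a ha => hR₂kill jW (Ne.symm hj'W) a (hW ▸ ha)
  have hW₃ : ∀ a ∈ M.nodeGp, R₃ a = a := fun a ha => hR₃fix a (hW ▸ ha)
  exact M.inf_conj_eq_bot_of_cross _ _ hTK hUK' R₁ R₂ R₃ hR₁ hR₁fix (hR₁kill j' (Ne.symm hjj')) hW₁ hR₂ hR₂fix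
    (hR₂kill j hjj') hW₂ hR₃ hW₃ hγ

/-- Reversing a cross pair: `A ∩ γBγ⁻¹ = 1` from `B ∩ γ⁻¹Aγ = 1`. [cite: MochizukiAbsTopII2013, Prop 1.3 (viii) p.12] -/
theorem inf_conj_eq_bot_of_symm {A B : Subgroup M.P} {γ : M.P} (h : B ⊓ MulAut.conj γ⁻¹ • A = ⊥) :
    A ⊓ MulAut.conj γ • B = ⊥ := by
  rw [eq_bot_iff]
  intro x hx
  obtain ⟨hxA, hxB⟩ := Subgroup.mem_inf.mp hx
  rw [Subgroup.mem_bot]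
  have h1 : (MulAut.conj γ)⁻¹ • x ∈ B := (Subgroup.mem_pointwise_smul_iff_inv_smul_mem).mp hxB
  have h2 : (MulAut.conj γ)⁻¹ • x ∈ MulAut.conj γ⁻¹ • A := by
    rw [map_inv]; exact Subgroup.smul_mem_pointwise_smul _ _ _ hxA
  have h3 : (MulAut.conj γ)⁻¹ • x ∈ B ⊓ MulAut.conj γ⁻¹ • A := ⟨h1, h2⟩
  rw [h, Subgroup.mem_bot, smul_eq_iff_eq_inv_smul, inv_inv, smul_one] at h3
  exact h3

/-! ### The twelve ordered pairs at a common vertex -/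

/-- At `v_A`: `c1`/`c2` — `D ∩ γ D' γ⁻¹ = T = I_{v_A} ∩ Z(γ)` for every `γ ∈ Π_𝔾`. [cite: MochizukiAbsTopII2013, Prop 1.3 (viii) p.12] -/
theorem Dc1_inf_conj_Dc2 (hne : Sigma.Nonempty) (hprime : ∀ p ∈ Sigma, p.Prime) {γ : (M.dpsc hne hprime).PiH}
    (hγ : γ ∈ M.PiG) :
    (M.dpsc hne hprime).DvCusp ⟨(1 : Fin 4)⟩ ⊓ MulAut.conj γ • (M.dpsc hne hprime).DvCusp ⟨(2 : Fin 4)⟩ =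
      M.T ⊓ Subgroup.centralizer ({γ} : Set M.P) := by
  obtain ⟨b, hb⟩ := exists_freeGroupBasis_succ
  have hb0 : b 0 = c 1 := hb 0
  have hb1 : b 1 = c 2 := hb 1
  have hb2 : b 2 = c 3 := hb 2
  rw [DvCusp_one_eq, DvCusp_two_eq]
  exact M.pair_same b (by decide : (0 : Fin 3) ≠ 1) _ _ (by rw [cuspGp_eq_closure_zpowers, hb0]) (by rw [cuspGp_eq_closure_zpowers, hb1]) M.T
    M.T_inf_PiG (M.T_le_centralizer_cuspGp M.twist_c_one) (M.T_le_centralizer_cuspGp M.twist_c_two) hγ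

/-- At `v_A`: `c2`/`c1` — `D ∩ γ D' γ⁻¹ = T = I_{v_A} ∩ Z(γ)` for every `γ ∈ Π_𝔾`. [cite: MochizukiAbsTopII2013, Prop 1.3 (viii) p.12] -/
theorem Dc2_inf_conj_Dc1 (hne : Sigma.Nonempty) (hprime : ∀ p ∈ Sigma, p.Prime) {γ : (M.dpsc hne hprime).PiH}
    (hγ : γ ∈ M.PiG) :
    (M.dpsc hne hprime).DvCusp ⟨(2 : Fin 4)⟩ ⊓ MulAut.conj γ • (M.dpsc hne hprime).DvCusp ⟨(1 : Fin 4)⟩ =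
      M.T ⊓ Subgroup.centralizer ({γ} : Set M.P) := by
  obtain ⟨b, hb⟩ := exists_freeGroupBasis_succ
  have hb0 : b 0 = c 1 := hb 0
  have hb1 : b 1 = c 2 := hb 1
  have hb2 : b 2 = c 3 := hb 2
  rw [DvCusp_two_eq, DvCusp_one_eq]
  exact M.pair_same b (by decide : (1 : Fin 3) ≠ 0) _ _ (by rw [cuspGp_eq_closure_zpowers, hb1]) (by rw [cuspGp_eq_closure_zpowers, hb0]) M.T
    M.T_inf_PiG (M.T_le_centralizer_cuspGp M.twist_c_two) (M.T_le_centralizer_cuspGp M.twist_c_one) hγ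

/-- At `v_A`: `e`/`c1` — `D ∩ γ D' γ⁻¹ = T = I_{v_A} ∩ Z(γ)` for every `γ ∈ Π_𝔾`. [cite: MochizukiAbsTopII2013, Prop 1.3 (viii) p.12] -/
theorem De_inf_conj_Dc1 (hne : Sigma.Nonempty) (hprime : ∀ p ∈ Sigma, p.Prime) (e : (M.dpsc hne hprime).Node) {γ : (M.dpsc hne hprime).PiH}
    (hγ : γ ∈ M.PiG) :
    (M.dpsc hne hprime).DvNode e ⊓ MulAut.conj γ • (M.dpsc hne hprime).DvCusp ⟨(1 : Fin 4)⟩ =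
      M.T ⊓ Subgroup.centralizer ({γ} : Set M.P) := by
  obtain ⟨b, hb0, hb1, hb2⟩ := exists_freeGroupBasis_node
  rw [DvNode_eq_WT, DvCusp_one_eq]
  exact M.pair_same b (by decide : (1 : Fin 3) ≠ 0) _ _ (by rw [nodeGp_eq_closure_zpowers, hb1]) (by rw [cuspGp_eq_closure_zpowers, hb0]) M.T
    M.T_inf_PiG M.T_le_centralizer_W (M.T_le_centralizer_cuspGp M.twist_c_one) hγ

/-- At `v_A`: `c1`/`e` — `D ∩ γ D' γ⁻¹ = T = I_{v_A} ∩ Z(γ)` for every `γ ∈ Π_𝔾`. [cite: MochizukiAbsTopII2013, Prop 1.3 (viii) p.12] -/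
theorem Dc1_inf_conj_De (hne : Sigma.Nonempty) (hprime : ∀ p ∈ Sigma, p.Prime) (e : (M.dpsc hne hprime).Node) {γ : (M.dpsc hne hprime).PiH}
    (hγ : γ ∈ M.PiG) :
    (M.dpsc hne hprime).DvCusp ⟨(1 : Fin 4)⟩ ⊓ MulAut.conj γ • (M.dpsc hne hprime).DvNode e =
      M.T ⊓ Subgroup.centralizer ({γ} : Set M.P) := by
  obtain ⟨b, hb0, hb1, hb2⟩ := exists_freeGroupBasis_node
  rw [DvCusp_one_eq, DvNode_eq_WT]
  exact M.pair_same b (by decide : (0 : Fin 3) ≠ 1) _ _ (by rw [cuspGp_eq_closure_zpowers, hb0]) (by rw [nodeGp_eq_closure_zpowers, hb1]) M.T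
    M.T_inf_PiG (M.T_le_centralizer_cuspGp M.twist_c_one) M.T_le_centralizer_W hγ

/-- At `v_A`: `e`/`c2` — `D ∩ γ D' γ⁻¹ = T = I_{v_A} ∩ Z(γ)` for every `γ ∈ Π_𝔾`. [cite: MochizukiAbsTopII2013, Prop 1.3 (viii) p.12] -/
theorem De_inf_conj_Dc2 (hne : Sigma.Nonempty) (hprime : ∀ p ∈ Sigma, p.Prime) (e : (M.dpsc hne hprime).Node) {γ : (M.dpsc hne hprime).PiH}
    (hγ : γ ∈ M.PiG) :
    (M.dpsc hne hprime).DvNode e ⊓ MulAut.conj γ • (M.dpsc hne hprime).DvCusp ⟨(2 : Fin 4)⟩ =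
      M.T ⊓ Subgroup.centralizer ({γ} : Set M.P) := by
  obtain ⟨b, hb0, hb1, hb2⟩ := exists_freeGroupBasis_node_two
  rw [DvNode_eq_WT, DvCusp_two_eq]
  exact M.pair_same b (by decide : (0 : Fin 3) ≠ 1) _ _ (by rw [nodeGp_eq_closure_zpowers, hb0]) (by rw [cuspGp_eq_closure_zpowers, hb1]) M.T
    M.T_inf_PiG M.T_le_centralizer_W (M.T_le_centralizer_cuspGp M.twist_c_two) hγ

/-- At `v_A`: `c2`/`e` — `D ∩ γ D' γ⁻¹ = T = I_{v_A} ∩ Z(γ)` for every `γ ∈ Π_𝔾`. [cite: MochizukiAbsTopII2013, Prop 1.3 (viii) p.12] -/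
theorem Dc2_inf_conj_De (hne : Sigma.Nonempty) (hprime : ∀ p ∈ Sigma, p.Prime) (e : (M.dpsc hne hprime).Node) {γ : (M.dpsc hne hprime).PiH}
    (hγ : γ ∈ M.PiG) :
    (M.dpsc hne hprime).DvCusp ⟨(2 : Fin 4)⟩ ⊓ MulAut.conj γ • (M.dpsc hne hprime).DvNode e =
      M.T ⊓ Subgroup.centralizer ({γ} : Set M.P) := by
  obtain ⟨b, hb0, hb1, hb2⟩ := exists_freeGroupBasis_node_two
  rw [DvCusp_two_eq, DvNode_eq_WT]
  exact M.pair_same b (by decide : (1 : Fin 3) ≠ 0) _ _ (by rw [cuspGp_eq_closure_zpowers, hb1]) (by rw [nodeGp_eq_closure_zpowers, hb0]) M.T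
    M.T_inf_PiG (M.T_le_centralizer_cuspGp M.twist_c_two) M.T_le_centralizer_W hγ

/-- At `v_B`: `c3`/`c0` — `D ∩ γ D' γ⁻¹ = U = I_{v_B} ∩ Z(γ)` for every `γ ∈ Π_𝔾`. [cite: MochizukiAbsTopII2013, Prop 1.3 (viii) p.12] -/
theorem Dc3_inf_conj_Dc0 (hne : Sigma.Nonempty) (hprime : ∀ p ∈ Sigma, p.Prime) {γ : (M.dpsc hne hprime).PiH}
    (hγ : γ ∈ M.PiG) :
    (M.dpsc hne hprime).DvCusp ⟨(3 : Fin 4)⟩ ⊓ MulAut.conj γ • (M.dpsc hne hprime).DvCusp ⟨(0 : Fin 4)⟩ =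
      M.U ⊓ Subgroup.centralizer ({γ} : Set M.P) := by
  obtain ⟨b, hb0, hb1, hb2⟩ := exists_freeGroupBasis_c1_c0inv_c3
  rw [DvCusp_three_eq, DvCusp_zero_eq]
  exact M.pair_same b (by decide : (2 : Fin 3) ≠ 1) _ _ (by rw [cuspGp_eq_closure_zpowers, hb2]) (by rw [cuspGp_zero_eq_closure_zpowers_inv, hb1]) M.U
    (M.U_inf_PiG hne hprime) (M.U_le_centralizer_cuspGp M.twist_c_three) (M.U_le_centralizer_cuspGp M.twist_c_zero) hγ

/-- At `v_B`: `c0`/`c3` — `D ∩ γ D' γ⁻¹ = U = I_{v_B} ∩ Z(γ)` for every `γ ∈ Π_𝔾`. [cite: MochizukiAbsTopII2013, Prop 1.3 (viii) p.12] -/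
theorem Dc0_inf_conj_Dc3 (hne : Sigma.Nonempty) (hprime : ∀ p ∈ Sigma, p.Prime) {γ : (M.dpsc hne hprime).PiH}
    (hγ : γ ∈ M.PiG) :
    (M.dpsc hne hprime).DvCusp ⟨(0 : Fin 4)⟩ ⊓ MulAut.conj γ • (M.dpsc hne hprime).DvCusp ⟨(3 : Fin 4)⟩ =
      M.U ⊓ Subgroup.centralizer ({γ} : Set M.P) := by
  obtain ⟨b, hb0, hb1, hb2⟩ := exists_freeGroupBasis_c1_c0inv_c3
  rw [DvCusp_zero_eq, DvCusp_three_eq]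
  exact M.pair_same b (by decide : (1 : Fin 3) ≠ 2) _ _ (by rw [cuspGp_zero_eq_closure_zpowers_inv, hb1]) (by rw [cuspGp_eq_closure_zpowers, hb2]) M.U
    (M.U_inf_PiG hne hprime) (M.U_le_centralizer_cuspGp M.twist_c_zero) (M.U_le_centralizer_cuspGp M.twist_c_three) hγ

/-- At `v_B`: `e`/`c3` — `D ∩ γ D' γ⁻¹ = U = I_{v_B} ∩ Z(γ)` for every `γ ∈ Π_𝔾`. [cite: MochizukiAbsTopII2013, Prop 1.3 (viii) p.12] -/
theorem De_inf_conj_Dc3 (hne : Sigma.Nonempty) (hprime : ∀ p ∈ Sigma, p.Prime) (e : (M.dpsc hne hprime).Node) {γ : (M.dpsc hne hprime).PiH}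
    (hγ : γ ∈ M.PiG) :
    (M.dpsc hne hprime).DvNode e ⊓ MulAut.conj γ • (M.dpsc hne hprime).DvCusp ⟨(3 : Fin 4)⟩ =
      M.U ⊓ Subgroup.centralizer ({γ} : Set M.P) := by
  obtain ⟨b, hb0, hb1, hb2⟩ := exists_freeGroupBasis_node
  rw [DvNode_eq_WU, DvCusp_three_eq]
  exact M.pair_same b (by decide : (1 : Fin 3) ≠ 2) _ _ (by rw [nodeGp_eq_closure_zpowers, hb1]) (by rw [cuspGp_eq_closure_zpowers, hb2]) M.U
    (M.U_inf_PiG hne hprime) M.U_le_centralizer_W (M.U_le_centralizer_cuspGp M.twist_c_three) hγ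

/-- At `v_B`: `c3`/`e` — `D ∩ γ D' γ⁻¹ = U = I_{v_B} ∩ Z(γ)` for every `γ ∈ Π_𝔾`. [cite: MochizukiAbsTopII2013, Prop 1.3 (viii) p.12] -/
theorem Dc3_inf_conj_De (hne : Sigma.Nonempty) (hprime : ∀ p ∈ Sigma, p.Prime) (e : (M.dpsc hne hprime).Node) {γ : (M.dpsc hne hprime).PiH}
    (hγ : γ ∈ M.PiG) :
    (M.dpsc hne hprime).DvCusp ⟨(3 : Fin 4)⟩ ⊓ MulAut.conj γ • (M.dpsc hne hprime).DvNode e =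
      M.U ⊓ Subgroup.centralizer ({γ} : Set M.P) := by
  obtain ⟨b, hb0, hb1, hb2⟩ := exists_freeGroupBasis_node
  rw [DvCusp_three_eq, DvNode_eq_WU]
  exact M.pair_same b (by decide : (2 : Fin 3) ≠ 1) _ _ (by rw [cuspGp_eq_closure_zpowers, hb2]) (by rw [nodeGp_eq_closure_zpowers, hb1]) M.U
    (M.U_inf_PiG hne hprime) (M.U_le_centralizer_cuspGp M.twist_c_three) M.U_le_centralizer_W hγ

/-- At `v_B`: `e`/`c0` — `D ∩ γ D' γ⁻¹ = U = I_{v_B} ∩ Z(γ)` for every `γ ∈ Π_𝔾`. [cite: MochizukiAbsTopII2013, Prop 1.3 (viii) p.12] -/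
theorem De_inf_conj_Dc0 (hne : Sigma.Nonempty) (hprime : ∀ p ∈ Sigma, p.Prime) (e : (M.dpsc hne hprime).Node) {γ : (M.dpsc hne hprime).PiH}
    (hγ : γ ∈ M.PiG) :
    (M.dpsc hne hprime).DvNode e ⊓ MulAut.conj γ • (M.dpsc hne hprime).DvCusp ⟨(0 : Fin 4)⟩ =
      M.U ⊓ Subgroup.centralizer ({γ} : Set M.P) := by
  obtain ⟨b, hb0, hb1, hb2⟩ := exists_freeGroupBasis_node_zero
  rw [DvNode_eq_WU, DvCusp_zero_eq]
  exact M.pair_same b (by decide : (1 : Fin 3) ≠ 2) _ _ (by rw [nodeGp_eq_closure_zpowers, hb1]) (by rw [cuspGp_zero_eq_closure_zpowers_inv, hb2]) M.U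
    (M.U_inf_PiG hne hprime) M.U_le_centralizer_W (M.U_le_centralizer_cuspGp M.twist_c_zero) hγ

/-- At `v_B`: `c0`/`e` — `D ∩ γ D' γ⁻¹ = U = I_{v_B} ∩ Z(γ)` for every `γ ∈ Π_𝔾`. [cite: MochizukiAbsTopII2013, Prop 1.3 (viii) p.12] -/
theorem Dc0_inf_conj_De (hne : Sigma.Nonempty) (hprime : ∀ p ∈ Sigma, p.Prime) (e : (M.dpsc hne hprime).Node) {γ : (M.dpsc hne hprime).PiH}
    (hγ : γ ∈ M.PiG) :
    (M.dpsc hne hprime).DvCusp ⟨(0 : Fin 4)⟩ ⊓ MulAut.conj γ • (M.dpsc hne hprime).DvNode e =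
      M.U ⊓ Subgroup.centralizer ({γ} : Set M.P) := by
  obtain ⟨b, hb0, hb1, hb2⟩ := exists_freeGroupBasis_node_zero
  rw [DvCusp_zero_eq, DvNode_eq_WU]
  exact M.pair_same b (by decide : (2 : Fin 3) ≠ 1) _ _ (by rw [cuspGp_zero_eq_closure_zpowers_inv, hb2]) (by rw [nodeGp_eq_closure_zpowers, hb1]) M.U
    (M.U_inf_PiG hne hprime) (M.U_le_centralizer_cuspGp M.twist_c_zero) M.U_le_centralizer_W hγ

/-! ### The eight ordered pairs with no common vertex -/

/-- `c1` (at `v_A`) against `c3` (at `v_B`): `D ∩ γ D' γ⁻¹ = 1` for every `γ ∈ Π_𝔾`. [cite: MochizukiAbsTopII2013, Prop 1.3 (viii) p.12] -/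
theorem Dc1_inf_conj_Dc3_eq_bot (hne : Sigma.Nonempty) (hprime : ∀ p ∈ Sigma, p.Prime) {γ : (M.dpsc hne hprime).PiH}
    (hγ : γ ∈ M.PiG) :
    (M.dpsc hne hprime).DvCusp ⟨(1 : Fin 4)⟩ ⊓ MulAut.conj γ • (M.dpsc hne hprime).DvCusp ⟨(3 : Fin 4)⟩ = ⊥ := by
  obtain ⟨b, hb0, hb1, hb2⟩ := exists_freeGroupBasis_node
  rw [DvCusp_one_eq, DvCusp_three_eq]
  exact M.pair_cross b (by decide : (0 : Fin 3) ≠ 2) (by decide : (0 : Fin 3) ≠ 1) (by decide : (2 : Fin 3) ≠ 1) _ _ (by rw [cuspGp_eq_closure_zpowers, hb0])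
    (by rw [cuspGp_eq_closure_zpowers, hb2]) (by rw [nodeGp_eq_closure_zpowers, hb1]) (M.T_le_centralizer_cuspGp M.twist_c_one) (M.U_le_centralizer_cuspGp M.twist_c_three) hγ

/-- `c3` (at `v_B`) against `c1` (at `v_A`): `D ∩ γ D' γ⁻¹ = 1` for every `γ ∈ Π_𝔾`. [cite: MochizukiAbsTopII2013, Prop 1.3 (viii) p.12] -/
theorem Dc3_inf_conj_Dc1_eq_bot (hne : Sigma.Nonempty) (hprime : ∀ p ∈ Sigma, p.Prime) {γ : (M.dpsc hne hprime).PiH}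
    (hγ : γ ∈ M.PiG) :
    (M.dpsc hne hprime).DvCusp ⟨(3 : Fin 4)⟩ ⊓ MulAut.conj γ • (M.dpsc hne hprime).DvCusp ⟨(1 : Fin 4)⟩ = ⊥ :=
  M.inf_conj_eq_bot_of_symm (M.Dc1_inf_conj_Dc3_eq_bot hne hprime (M.PiG.inv_mem hγ))

/-- `c2` (at `v_A`) against `c3` (at `v_B`): `D ∩ γ D' γ⁻¹ = 1` for every `γ ∈ Π_𝔾`. [cite: MochizukiAbsTopII2013, Prop 1.3 (viii) p.12] -/
theorem Dc2_inf_conj_Dc3_eq_bot (hne : Sigma.Nonempty) (hprime : ∀ p ∈ Sigma, p.Prime) {γ : (M.dpsc hne hprime).PiH}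
    (hγ : γ ∈ M.PiG) :
    (M.dpsc hne hprime).DvCusp ⟨(2 : Fin 4)⟩ ⊓ MulAut.conj γ • (M.dpsc hne hprime).DvCusp ⟨(3 : Fin 4)⟩ = ⊥ := by
  obtain ⟨b, hb0, hb1, hb2⟩ := exists_freeGroupBasis_node_two
  rw [DvCusp_two_eq, DvCusp_three_eq]
  exact M.pair_cross b (by decide : (1 : Fin 3) ≠ 2) (by decide : (1 : Fin 3) ≠ 0) (by decide : (2 : Fin 3) ≠ 0) _ _ (by rw [cuspGp_eq_closure_zpowers, hb1])
    (by rw [cuspGp_eq_closure_zpowers, hb2]) (by rw [nodeGp_eq_closure_zpowers, hb0]) (M.T_le_centralizer_cuspGp M.twist_c_two) (M.U_le_centralizer_cuspGp M.twist_c_three) hγ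

/-- `c3` (at `v_B`) against `c2` (at `v_A`): `D ∩ γ D' γ⁻¹ = 1` for every `γ ∈ Π_𝔾`. [cite: MochizukiAbsTopII2013, Prop 1.3 (viii) p.12] -/
theorem Dc3_inf_conj_Dc2_eq_bot (hne : Sigma.Nonempty) (hprime : ∀ p ∈ Sigma, p.Prime) {γ : (M.dpsc hne hprime).PiH}
    (hγ : γ ∈ M.PiG) :
    (M.dpsc hne hprime).DvCusp ⟨(3 : Fin 4)⟩ ⊓ MulAut.conj γ • (M.dpsc hne hprime).DvCusp ⟨(2 : Fin 4)⟩ = ⊥ :=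
  M.inf_conj_eq_bot_of_symm (M.Dc2_inf_conj_Dc3_eq_bot hne hprime (M.PiG.inv_mem hγ))

/-- `c1` (at `v_A`) against `c0` (at `v_B`): `D ∩ γ D' γ⁻¹ = 1` for every `γ ∈ Π_𝔾`. [cite: MochizukiAbsTopII2013, Prop 1.3 (viii) p.12] -/
theorem Dc1_inf_conj_Dc0_eq_bot (hne : Sigma.Nonempty) (hprime : ∀ p ∈ Sigma, p.Prime) {γ : (M.dpsc hne hprime).PiH}
    (hγ : γ ∈ M.PiG) :
    (M.dpsc hne hprime).DvCusp ⟨(1 : Fin 4)⟩ ⊓ MulAut.conj γ • (M.dpsc hne hprime).DvCusp ⟨(0 : Fin 4)⟩ = ⊥ := by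
  obtain ⟨b, hb0, hb1, hb2⟩ := exists_freeGroupBasis_node_zero
  rw [DvCusp_one_eq, DvCusp_zero_eq]
  exact M.pair_cross b (by decide : (0 : Fin 3) ≠ 2) (by decide : (0 : Fin 3) ≠ 1) (by decide : (2 : Fin 3) ≠ 1) _ _ (by rw [cuspGp_eq_closure_zpowers, hb0])
    (by rw [cuspGp_zero_eq_closure_zpowers_inv, hb2]) (by rw [nodeGp_eq_closure_zpowers, hb1]) (M.T_le_centralizer_cuspGp M.twist_c_one) (M.U_le_centralizer_cuspGp M.twist_c_zero) hγ

/-- `c0` (at `v_B`) against `c1` (at `v_A`): `D ∩ γ D' γ⁻¹ = 1` for every `γ ∈ Π_𝔾`. [cite: MochizukiAbsTopII2013, Prop 1.3 (viii) p.12] -/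
theorem Dc0_inf_conj_Dc1_eq_bot (hne : Sigma.Nonempty) (hprime : ∀ p ∈ Sigma, p.Prime) {γ : (M.dpsc hne hprime).PiH}
    (hγ : γ ∈ M.PiG) :
    (M.dpsc hne hprime).DvCusp ⟨(0 : Fin 4)⟩ ⊓ MulAut.conj γ • (M.dpsc hne hprime).DvCusp ⟨(1 : Fin 4)⟩ = ⊥ :=
  M.inf_conj_eq_bot_of_symm (M.Dc1_inf_conj_Dc0_eq_bot hne hprime (M.PiG.inv_mem hγ))

/-- `c2` (at `v_A`) against `c0` (at `v_B`): `D ∩ γ D' γ⁻¹ = 1` for every `γ ∈ Π_𝔾`. [cite: MochizukiAbsTopII2013, Prop 1.3 (viii) p.12] -/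
theorem Dc2_inf_conj_Dc0_eq_bot (hne : Sigma.Nonempty) (hprime : ∀ p ∈ Sigma, p.Prime) {γ : (M.dpsc hne hprime).PiH}
    (hγ : γ ∈ M.PiG) :
    (M.dpsc hne hprime).DvCusp ⟨(2 : Fin 4)⟩ ⊓ MulAut.conj γ • (M.dpsc hne hprime).DvCusp ⟨(0 : Fin 4)⟩ = ⊥ := by
  obtain ⟨b, hb0, hb1, hb2⟩ := exists_freeGroupBasis_node_c2_c0inv
  rw [DvCusp_two_eq, DvCusp_zero_eq]
  exact M.pair_cross b (by decide : (1 : Fin 3) ≠ 2) (by decide : (1 : Fin 3) ≠ 0) (by decide : (2 : Fin 3) ≠ 0) _ _ (by rw [cuspGp_eq_closure_zpowers, hb1])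
    (by rw [cuspGp_zero_eq_closure_zpowers_inv, hb2]) (by rw [nodeGp_eq_closure_zpowers, hb0]) (M.T_le_centralizer_cuspGp M.twist_c_two) (M.U_le_centralizer_cuspGp M.twist_c_zero) hγ

/-- `c0` (at `v_B`) against `c2` (at `v_A`): `D ∩ γ D' γ⁻¹ = 1` for every `γ ∈ Π_𝔾`. [cite: MochizukiAbsTopII2013, Prop 1.3 (viii) p.12] -/
theorem Dc0_inf_conj_Dc2_eq_bot (hne : Sigma.Nonempty) (hprime : ∀ p ∈ Sigma, p.Prime) {γ : (M.dpsc hne hprime).PiH}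
    (hγ : γ ∈ M.PiG) :
    (M.dpsc hne hprime).DvCusp ⟨(0 : Fin 4)⟩ ⊓ MulAut.conj γ • (M.dpsc hne hprime).DvCusp ⟨(2 : Fin 4)⟩ = ⊥ :=
  M.inf_conj_eq_bot_of_symm (M.Dc2_inf_conj_Dc0_eq_bot hne hprime (M.PiG.inv_mem hγ))

end Literature.AnabelianGeometry.AbsoluteAnabelian.AbsTopII.TwoTripodNodal.Model

end
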